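import Summits.PneNP.PneNP.Theorems.ConvexRankGatesConvexGateBlindExactLiftingTriangleIsolationBlocks

/-!
# Triangle instance — line isolation, file 2: two lower bounds for doubly-prescribed block sums

Support file for crux `ConvexGateBlind` (stmt-PneNP-10680), open stub `stub_exactLifting`; prover seat 0, session 22,
memo ANALYSIS12 (Theorem B). Two one-block lower bounds with two prescribed vertices, used for the positivity
constant of the usage-averaged kernel (`sum_dc_fix2_ge`) and for the mass of the good colourings in the off-line
comparison (`sum_cp_fix2_ge`):
* `(t−2)·2^t ≤ 8 ∑_{y : y a = c, y a' = c'} dc y a'` (consistent prescriptions, `a = a'` allowed);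
* `(t−1)(t−2)·2^t ≤ 16 ∑_{y : y d = c, y d' = c} cp y` (`d ≠ d'`).
-/

set_option linter.dupNamespace false -- `Summit.PneNP.PneNP.…`: summit = sub-problem (D-0017)

namespace Summit.PneNP.PneNP.Theorems.XorDoor.TriLine

open Finset

variable {t : ℕ}

/-- exchanging the order: `∑_v #{y ∈ F : y v ≠ y a'} = ∑_{y ∈ F} dc y a'` -/
lemma sum_card_filter_ne_eq (F : (Fin t → Bool) → Prop) [DecidablePred F] (a' : Fin t) :
    ∑ v, #(univ.filter fun y : Fin t → Bool => F y ∧ y v ≠ y a') = ∑ y ∈ univ.filter F, dc y a' := by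
  simp only [card_filter]
  rw [sum_comm, sum_filter]
  refine sum_congr rfl fun y _ => ?_
  by_cases hy : F y
  · rw [if_pos hy, dc, card_filter]
    refine sum_congr rfl fun v _ => ?_
    simp [hy]
  · rw [if_neg hy]
    refine sum_eq_zero fun v _ => ?_
    simp [hy]

/-- **Kernel positivity block bound.** `(t−2)·2^t ≤ 8 ∑_{y : y a = c, y a' = c'} dc y a'`. -/
lemma sum_dc_fix2_ge (a a' : Fin t) (c c' : Bool) (hc : a = a' → c = c') :
    (t - 2) * 2 ^ t ≤ 8 * ∑ y ∈ univ.filter (fun y : Fin t → Bool => y a = c ∧ y a' = c'), dc y a' := by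
  have step : ∀ v, v ≠ a → v ≠ a' →
      2 ^ t ≤ 8 * #(univ.filter fun y : Fin t → Bool => (y a = c ∧ y a' = c') ∧ y v ≠ y a') := by
    intro v hva hva'
    have hset : (univ.filter fun y : Fin t → Bool => (y a = c ∧ y a' = c') ∧ y v ≠ y a')
        = univ.filter fun y : Fin t → Bool => y v = !c' ∧ (y a = c ∧ y a' = c') := by
      ext y
      simp only [mem_filter, mem_univ, true_and]
      constructor
      · rintro ⟨⟨h1, h2⟩, h3⟩
        rw [h2] at h3
        refine ⟨?_, h1, h2⟩
        cases hv : y v <;> cases c' <;> simp_all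
      · rintro ⟨h3, h1, h2⟩
        refine ⟨⟨h1, h2⟩, ?_⟩
        rw [h2, h3]
        cases c' <;> simp
    rw [hset]
    by_cases haa : a = a'
    · subst haa
      have hcc := hc rfl
      subst hcc
      have hset' : (univ.filter fun y : Fin t → Bool => y v = !c ∧ (y a = c ∧ y a = c))
          = univ.filter fun y : Fin t → Bool => y v = !c ∧ y a = c := by
        ext y; simp
      rw [hset']
      have h4 := four_mul_card_fix2 hva (!c) c
      omega
    · have h8 := eight_mul_card_fix3 hva hva' haa (!c') c c'
      omega
  have hcard : t - 2 ≤ #(univ \ ({a, a'} : Finset (Fin t))) := by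
    rw [card_sdiff_of_subset (subset_univ _), card_univ, Fintype.card_fin]
    exact Nat.sub_le_sub_left (card_le_two) t
  calc (t - 2) * 2 ^ t ≤ #(univ \ ({a, a'} : Finset (Fin t))) * 2 ^ t := Nat.mul_le_mul_right _ hcard
    _ = ∑ v ∈ univ \ ({a, a'} : Finset (Fin t)), 2 ^ t := by rw [sum_const, smul_eq_mul]
    _ ≤ ∑ v ∈ univ \ ({a, a'} : Finset (Fin t)),
          8 * #(univ.filter fun y : Fin t → Bool => (y a = c ∧ y a' = c') ∧ y v ≠ y a') := by
        refine sum_le_sum fun v hv => step v ?_ ?_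
        · intro h; rw [h] at hv; simp at hv
        · intro h; rw [h] at hv; simp at hv
    _ ≤ ∑ v, 8 * #(univ.filter fun y : Fin t → Bool => (y a = c ∧ y a' = c') ∧ y v ≠ y a') :=
        sum_le_univ_sum_of_nonneg fun v => Nat.zero_le _
    _ = 8 * ∑ y ∈ univ.filter (fun y : Fin t → Bool => y a = c ∧ y a' = c'), dc y a' := by
        rw [← mul_sum, sum_card_filter_ne_eq]

/-- `cp y` as a count of ordered pairs `(v, v')` with `y v = c`, `y v' = ¬c` -/
lemma cp_eq_sum_pairs (y : Fin t → Bool) (c : Bool) :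
    cp y = ∑ v, ∑ v', (if y v = c ∧ y v' = !c then 1 else 0) := by
  rw [cp_eq y c, cls, cls, card_filter, card_filter, sum_mul_sum]
  refine sum_congr rfl fun v _ => sum_congr rfl fun v' _ => ?_
  split_ifs <;> simp_all

/-- exchanging the order: `∑_{v,v'} #{y ∈ F : y v = c, y v' = ¬c} = ∑_{y ∈ F} cp y` -/
lemma sum_card_filter_pair_eq (F : (Fin t → Bool) → Prop) [DecidablePred F] (c : Bool) :
    ∑ v, ∑ v', #(univ.filter fun y : Fin t → Bool => F y ∧ (y v = c ∧ y v' = !c))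
      = ∑ y ∈ univ.filter F, cp y := by
  simp only [card_filter]
  rw [sum_filter]
  have h : ∀ y : Fin t → Bool, (if F y then cp y else 0)
      = ∑ v, ∑ v', (if F y ∧ (y v = c ∧ y v' = !c) then 1 else 0) := by
    intro y
    by_cases hy : F y
    · rw [if_pos hy, cp_eq_sum_pairs y c]
      refine sum_congr rfl fun v _ => sum_congr rfl fun v' _ => ?_
      simp [hy]
    · rw [if_neg hy]
      symm
      refine sum_eq_zero fun v _ => sum_eq_zero fun v' _ => ?_
      simp [hy]
  simp only [h]
  symm
  calc ∑ y : Fin t → Bool, ∑ v, ∑ v', (if F y ∧ (y v = c ∧ y v' = !c) then 1 else 0)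
      = ∑ v, ∑ y : Fin t → Bool, ∑ v', (if F y ∧ (y v = c ∧ y v' = !c) then 1 else 0) := sum_comm
    _ = ∑ v, ∑ v', ∑ y : Fin t → Bool, (if F y ∧ (y v = c ∧ y v' = !c) then 1 else 0) :=
        sum_congr rfl fun v _ => sum_comm

/-- **Good-colourings block bound.** `(t−1)(t−2)·2^t ≤ 16 ∑_{y : y d = c, y d' = c} cp y` for `d ≠ d'`. -/
lemma sum_cp_fix2_ge {d d' : Fin t} (hd : d ≠ d') (c : Bool) :
    (t - 1) * (t - 2) * 2 ^ t
      ≤ 16 * ∑ y ∈ univ.filter (fun y : Fin t → Bool => y d = c ∧ y d' = c), cp y := by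
  -- termwise bound for the good pairs `(v, v')`: `v' ∉ {d, d'}`, `v ≠ v'`
  have step : ∀ v v', v' ≠ d → v' ≠ d' → v ≠ v' →
      2 ^ t ≤ 16 * #(univ.filter fun y : Fin t → Bool => (y d = c ∧ y d' = c) ∧ (y v = c ∧ y v' = !c)) := by
    intro v v' h1 h2 h3
    by_cases hvd : v = d
    · subst hvd
      have hset : (univ.filter fun y : Fin t → Bool => (y v = c ∧ y d' = c) ∧ (y v = c ∧ y v' = !c))
          = univ.filter fun y : Fin t → Bool => y v' = !c ∧ (y v = c ∧ y d' = c) := by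
        ext y; simp only [mem_filter, mem_univ, true_and]; tauto
      rw [hset]
      have h8 := eight_mul_card_fix3 h1 h2 hd (!c) c c
      omega
    by_cases hvd' : v = d'
    · subst hvd'
      have hset : (univ.filter fun y : Fin t → Bool => (y d = c ∧ y v = c) ∧ (y v = c ∧ y v' = !c))
          = univ.filter fun y : Fin t → Bool => y v' = !c ∧ (y d = c ∧ y v = c) := by
        ext y; simp only [mem_filter, mem_univ, true_and]; tauto
      rw [hset]
      have h8 := eight_mul_card_fix3 h1 h2 hd (!c) c c
      omega
    · have hset : (univ.filter fun y : Fin t → Bool => (y d = c ∧ y d' = c) ∧ (y v = c ∧ y v' = !c))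
          = univ.filter fun y : Fin t → Bool => y v' = !c ∧ (y v = c ∧ (y d = c ∧ y d' = c)) := by
        ext y; simp only [mem_filter, mem_univ, true_and]; tauto
      rw [hset]
      have h16 := sixteen_mul_card_fix4 (Ne.symm h3) h1 h2 hvd hvd' hd (!c) c c c
      omega
  -- the good pairs, summed as `∑_{v' ∉ {d,d'}} ∑_{v ≠ v'}`
  have hcard : t - 2 ≤ #(univ \ ({d, d'} : Finset (Fin t))) := by
    rw [card_sdiff_of_subset (subset_univ _), card_univ, Fintype.card_fin]
    exact Nat.sub_le_sub_left (card_le_two) t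
  have hcard' : ∀ v' : Fin t, #(univ.erase v') = t - 1 := fun v' => by
    rw [card_erase_of_mem (mem_univ v'), card_univ, Fintype.card_fin]
  calc (t - 1) * (t - 2) * 2 ^ t
      ≤ (t - 1) * #(univ \ ({d, d'} : Finset (Fin t))) * 2 ^ t :=
        Nat.mul_le_mul_right _ (Nat.mul_le_mul_left _ hcard)
    _ = ∑ v' ∈ univ \ ({d, d'} : Finset (Fin t)), ∑ v ∈ univ.erase v', 2 ^ t := by
        simp only [sum_const, smul_eq_mul, hcard']
        ring
    _ ≤ ∑ v' ∈ univ \ ({d, d'} : Finset (Fin t)), ∑ v ∈ univ.erase v',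
          16 * #(univ.filter fun y : Fin t → Bool => (y d = c ∧ y d' = c) ∧ (y v = c ∧ y v' = !c)) := by
        refine sum_le_sum fun v' hv' => sum_le_sum fun v hv => step v v' ?_ ?_ (ne_of_mem_erase hv)
        · intro h; rw [h] at hv'; simp at hv'
        · intro h; rw [h] at hv'; simp at hv'
    _ ≤ ∑ v', ∑ v ∈ univ.erase v',
          16 * #(univ.filter fun y : Fin t → Bool => (y d = c ∧ y d' = c) ∧ (y v = c ∧ y v' = !c)) :=
        sum_le_univ_sum_of_nonneg fun v' => Nat.zero_le _
    _ ≤ ∑ v', ∑ v, 16 * #(univ.filter fun y : Fin t → Bool => (y d = c ∧ y d' = c) ∧ (y v = c ∧ y v' = !c)) :=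
        sum_le_sum fun v' _ => sum_le_univ_sum_of_nonneg fun v => Nat.zero_le _
    _ = 16 * ∑ y ∈ univ.filter (fun y : Fin t → Bool => y d = c ∧ y d' = c), cp y := by
        rw [← sum_card_filter_pair_eq _ c, mul_sum, sum_comm]
        simp only [mul_sum]


/-- **Doubly-prescribed class-size product bound** — registered sub-goal `block_two_fixed_class_product_ge` of
stmt-PneNP-10680, verbatim signature (see `sum_cp_fix2_ge`): `(t−1)(t−2) 2^t ≤ 16 ∑_{y : y d = y d' = c} #A_y #B_y`. -/
theorem block_two_fixed_class_product_ge : ∀ (t : ℕ) (d d' : Fin t) (c : Bool), d ≠ d' → (t - 1) * (t - 2) * 2 ^ t ≤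
    16 * ∑ y ∈ Finset.univ.filter (fun y : Fin t → Bool => y d = c ∧ y d' = c), (Finset.univ.filter fun v => y v =
    true).card * (Finset.univ.filter fun v => y v = false).card :=
  fun _ _ _ c hd => sum_cp_fix2_ge hd c

end Summit.PneNP.PneNP.Theorems.XorDoor.TriLine
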